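import Literature.AlgebraicGeometry.HodgeTheory.HyperplaneClassRational
import HarnessLib

/-!
# The hyperplane class restricts non-trivially to every positive-dimensional subvariety (proved)

Family `hodge`, layer `Literature/AlgebraicGeometry/HodgeTheory`. Companion of `HyperplaneClassRational`
(Voisin I Thm. 7.10 / §7.1.2 up to a complex scalar: for a closed immersion `ι : X ⟶ ℙᴺ` of a smooth
projective `X`, the hyperplane-type class `H` — the class of the restricted Fubini–Study form `θ_ι` read
through a Hodge model — satisfies `H = r • ι^* c_P`, `r ≠ 0`, for the Fubini–Study class `c_P` of
`ℙᴺ`, and `H ≠ 0` is a Kähler class when `dim X ≥ 1`). This file records the consequence that the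
Lefschetz-pencil descent (`PencilStepBelowMiddleProofs`) uses to see the class of the incidence
divisor on a slice: **for every closed immersion `ι : X ⟶ ℙᴺ_ℂ` of a smooth projective `X` of
dimension `n ≥ 1` and every non-zero `c ∈ H²(ℙᴺ(ℂ); ℂ)`, the restriction `ι^* c ∈ H²(X(ℂ); ℂ)` is
non-zero** (`complexBetti_map_two_ne_zero_of_isClosedImmersion`). In print: `c` is a non-zero
multiple of `h = c₁(𝒪(1))` and `∫_X ι^* hⁿ = deg X > 0` (Voisin I §3.3.2, Lemma 3.16 and the remark
following it: the Kähler form of a projective submanifold is the restriction of the Fubini–Study form;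
§7.1.2); here, as in `HyperplaneClassRational`, with no integrality: `H²(ℙᴺ(ℂ); ℂ)` is a line
(Hatcher Thm. 3.19), `ι^* c_P` is a non-zero multiple of the Kähler class `H` by the naturality of
the restricted Fubini–Study form (`HodgeModel.fubiniStudyPullbackForm_pullback_anMap`) and the
rigidity of natural de Rham comparisons (`NaturalDeRhamComparisonRigidity_holds`), and `H ≠ 0`
(`HodgeModel.IsKaehlerClassVia.ne_zero`).

Everything is proved; no definitions, no named facts (D-0026).

## References

* [VoisinHodgeI2002] C. Voisin, Hodge Theory and Complex Algebraic Geometry I (CUP 2002), §3.3.2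
  (Lemma 3.16 and the remark following it), §7.1.2, Thm. 7.10.
* [HatcherAT2002] A. Hatcher, Algebraic Topology (CUP 2002), Thm. 3.19.
* [SerreGAGA1956] J.-P. Serre, GAGA, Ann. Inst. Fourier 6 (1956), §2 n°5.
-/

noncomputable section

open scoped Manifold ContDiff
open CategoryTheory AlgebraicGeometry

namespace Literature.AlgebraicGeometry.HodgeTheory

section HodgeTheory

open Literature.AlgebraicTopology.SingularHomology Literature.Geometry.Kaehler
open Literature.NumberTheory.Transcendental
open Literature.AlgebraicGeometry.Motives (projectiveSpace ComplexPoints IsSmoothProjective)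
open Literature.AlgebraicGeometry.Motives.AnalytificationKaehler (fubiniStudyPullbackForm)

variable {n : ℕ} {X : Motives.SchemeOver ℂ}

/-- `X^an` is compact for `X` smooth projective (`X` proper, `X(ℂ)` compact, `X^an ≃ₜ X(ℂ)`). Local
copy of the private lemma of `HyperplaneClassRational`. [cite: SerreGAGA1956, §2 n°7 Prop. 6] -/
private theorem compactSpace_carrier₁ (A : HodgeModel n X) (hX : IsSmoothProjective n X) :
    CompactSpace A.carrier := by
  haveI : IsProper X.hom := Motives.IsSmoothProjective.isProper_holds hX
  haveI : CompactSpace (ComplexPoints X) := Motives.compactSpace_algPoints_of_isProper_holds X ℂ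
  exact A.isAnalytification.homeomorph.symm.compactSpace

/-- **The restriction of a non-zero class of `H²(ℙᴺ(ℂ); ℂ)` to a positive-dimensional smooth closed
subvariety is non-zero**: for `X` smooth projective of dimension `n ≥ 1` over `ℂ`, a closed immersion
`ι : X ⟶ ℙᴺ_ℂ` and `c ∈ H²(ℙᴺ(ℂ); ℂ)`, `c ≠ 0`, the class `ι^* c ∈ H²(X(ℂ); ℂ)` is non-zero. In print:
`c` is a non-zero multiple of the hyperplane class `h` and `ι^* h` is the Kähler class of the induced
projective embedding (Voisin I §3.3.2: the Kähler form of a projective submanifold is the restriction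
of the Fubini–Study form; a Kähler class on a compact complex manifold of positive dimension is
non-zero, `∫ ωⁿ > 0`). Here: `H²(ℙᴺ(ℂ); ℂ) = ℂ · r₀` (Hatcher Thm. 3.19), the Kähler class `H` of
`(X, ι)` is a multiple of `ι^* c_P` (naturality of the restricted Fubini–Study form and rigidity of
natural de Rham comparisons, as in `exists_ne_zero_smul_isRationalClass_of_pullback_eq_fubiniStudy`)
and `H ≠ 0`
(`HodgeModel.IsKaehlerClassVia.ne_zero`), so `ι^* r₀ ≠ 0`.
[cite: VoisinHodgeI2002, §3.3.2 Lemma 3.16 and the remark following it, §7.1.2]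
[cite: HatcherAT2002, Thm. 3.19] -/
theorem complexBetti_map_two_ne_zero_of_isClosedImmersion (hX : IsSmoothProjective n X) (hn : 1 ≤ n)
    {N : ℕ} (ι : X ⟶ projectiveSpace N ℂ) [IsClosedImmersion ι.left]
    {c : complexBetti (projectiveSpace N ℂ) 2} (hc : c ≠ 0) :
    complexBetti.map ι 2 c ≠ 0 := by
  have hP : IsSmoothProjective N (projectiveSpace N ℂ) := isSmoothProjective_projectiveSpace' N
  -- a Hodge model `A` of `X`, a natural real family `e`, and the Kähler class `H` of `(A, e, ι)`
  obtain ⟨A⟩ := (nonempty_hodgeModel_holds (n := n) (X := X)).nonempty hX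
  obtain ⟨e, he, -, -⟩ := exists_deRhamIsoFamily_holds A.model
  have hθ := A.fubiniStudyPullbackForm_mem_closedSmoothForms ι
  obtain ⟨H, hH⟩ := A.pullback_surjective 2 (ofRealClass A.carrier 2 (e A.carrier 2
    (deRhamCohomology.mk ⟨fubiniStudyPullbackForm A.model ι A.toComplexPoints, hθ⟩)))
  have hK : A.IsKaehlerClassVia e H := A.isKaehlerClassVia_of_pullback_eq_fubiniStudyPullbackForm e hX ι hθ hH
  have hH0 : H ≠ 0 := hK.ne_zero hX hn
  -- a Hodge model `B` of `ℙᴺ` with comparison `e_P ⊗ ℂ`, and its Fubini–Study class `c_P`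
  obtain ⟨B₀⟩ := (nonempty_hodgeModel_holds (n := N) (X := projectiveSpace N ℂ)).nonempty hP
  obtain ⟨eP, heP, -, -⟩ := exists_deRhamIsoFamily_holds B₀.model
  let B : HodgeModel N (projectiveSpace N ℂ) :=
    { B₀ with
      deRham := eP.complexify
      deRham_isNatural := DeRhamIsoFamily.complexify_isNatural heP }
  haveI : IsClosedImmersion (𝟙 (projectiveSpace N ℂ) : projectiveSpace N ℂ ⟶ projectiveSpace N ℂ).left :=
    show IsClosedImmersion (𝟙 (projectiveSpace N ℂ).left) from inferInstance
  have hθP := B.fubiniStudyPullbackForm_mem_closedSmoothForms (𝟙 (projectiveSpace N ℂ))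
  obtain ⟨cP, hcP⟩ := B.pullback_surjective 2 (ofRealClass B.carrier 2 (eP B.carrier 2
    (deRhamCohomology.mk ⟨fubiniStudyPullbackForm B.model (𝟙 (projectiveSpace N ℂ)) B.toComplexPoints, hθP⟩)))
  -- `H = r • ι^* c_P` (steps (2)–(3) of `exists_ne_zero_smul_isRationalClass_of_pullback_eq_fubiniStudy`)
  have hnN : n ≤ N := le_of_isClosedImmersion_projectiveSpace hX ι
  set H₁ : complexBetti X 2 :=
    singularCohomology.map ℂ ℂ (Motives.AlgPoints.mapContinuous (L := ℂ) ι) 2 cP with hH₁def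
  -- (2) in the induced model: `A^* H₁ = e''[(ι^an)^* θ_P ⊗ 1]`
  have hfan : ContMDiff 𝓘(ℝ, A.model) 𝓘(ℝ, B.model) ∞ (HodgeModel.anMap B A ι) :=
    HodgeModel.contMDiff_anMap B A ι hX hP
  set wP : complexDeRhamCohomology B.model B.carrier 2 := complexDeRhamCohomology.ofReal B.model B.carrier 2
    (deRhamCohomology.mk ⟨fubiniStudyPullbackForm B.model (𝟙 (projectiveSpace N ℂ)) B.toComplexPoints, hθP⟩)
    with hwPdef
  have hwc : B.pullback 2 cP = B.deRham B.carrier 2 wP := by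
    rw [hcP, hwPdef]
    exact (complexifyFun_ofReal eP 2 _).symm
  have key : A.pullback 2 H₁ =
      HodgeModel.inducedIso B A hnN A.carrier 2 (complexDeRhamCohomology.map A.model hfan 2 wP) := by
    rw [HodgeModel.inducedIso_apply, ← LinearMap.comp_apply
        (g := complexDeRhamCohomology.map A.model hfan 2),
      ← complexDeRhamCohomology.map_comp hfan (contMDiff_cylFst B A hnN A.carrier),
      B.deRham_isNatural (Cyl B A hnN A.carrier) B.carrier _
        (hfan.comp (contMDiff_cylFst B A hnN A.carrier)) 2 wP,
      ← hwc, ← HodgeModel.map_anMap_pullback]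
    change _ = ((singularCohomology.map ℂ ℂ _ 2 ≫ singularCohomology.map ℂ ℂ _ 2).hom _)
    rw [← singularCohomology.map_comp]
    rfl
  -- the pulled-back form is `θ_ι`
  have hpull : (fubiniStudyPullbackForm B.model (𝟙 (projectiveSpace N ℂ)) B.toComplexPoints).pullback
      𝓘(ℝ, A.model) (HodgeModel.anMap B A ι) = fubiniStudyPullbackForm A.model ι A.toComplexPoints := by
    have h := A.fubiniStudyPullbackForm_pullback_anMap B ι (𝟙 (projectiveSpace N ℂ)) hX hP
    rwa [Category.comp_id] at h
  have hmap : complexDeRhamCohomology.map A.model hfan 2 wP =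
      complexDeRhamCohomology.ofReal A.model A.carrier 2
        (deRhamCohomology.mk ⟨fubiniStudyPullbackForm A.model ι A.toComplexPoints, hθ⟩) := by
    haveI : PullbackFacts 𝓘(ℝ, A.model) A.carrier 𝓘(ℝ, B.model) B.carrier ℝ := PullbackFacts.real_of_complex
    rw [hwPdef, ← complexDeRhamCohomology.ofReal_map, deRhamCohomology.map_mk]
    congr 2
    exact Subtype.ext hpull
  -- (3) rigidity: `e'' = r • (e ⊗ ℂ)` on `H²_dR(X^an; ℂ)`
  haveI : CompactSpace A.carrier := compactSpace_carrier₁ A hX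
  obtain ⟨r, hr⟩ := NaturalDeRhamComparisonRigidity_holds A.model A.model (HodgeModel.inducedFamily B A hnN)
    (HodgeModel.isNatural_inducedFamily B A hnN) e.complexify (DeRhamIsoFamily.complexify_isNatural he)
    A.carrier A.carrier (Homeomorph.refl A.carrier) contMDiff_id contMDiff_id 2
  have hr' : ∀ y : complexDeRhamCohomology A.model A.carrier 2,
      e.complexify A.carrier 2 y = r • HodgeModel.inducedIso B A hnN A.carrier 2 y := by
    intro y
    have h := hr y
    have h1 : (⟨Homeomorph.refl A.carrier, (Homeomorph.refl A.carrier).continuous⟩ : C(A.carrier, A.carrier)) =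
        ContinuousMap.id A.carrier := rfl
    have h2 : complexDeRhamCohomology.map A.model
        (contMDiff_id : ContMDiff 𝓘(ℝ, A.model) 𝓘(ℝ, A.model) ∞ (Homeomorph.refl A.carrier)) 2 =
          LinearMap.id :=
      complexDeRhamCohomology.map_id (E := A.model) (M := A.carrier) 2
    have lhs : singularCohomology.map ℂ ℂ
        (⟨Homeomorph.refl A.carrier, (Homeomorph.refl A.carrier).continuous⟩ : C(A.carrier, A.carrier)) 2
          (e.complexify A.carrier 2 y) = e.complexify A.carrier 2 y := by
      rw [h1, singularCohomology.map_id]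
      rfl
    have rhs : HodgeModel.inducedFamily B A hnN A.carrier 2 (complexDeRhamCohomology.map A.model
        (contMDiff_id : ContMDiff 𝓘(ℝ, A.model) 𝓘(ℝ, A.model) ∞ (Homeomorph.refl A.carrier)) 2 y) =
          HodgeModel.inducedIso B A hnN A.carrier 2 y :=
      congrArg (HodgeModel.inducedIso B A hnN A.carrier 2) (LinearMap.congr_fun h2 y)
    exact lhs.symm.trans (h.trans (congrArg (r • ·) rhs))
  -- `e ⊗ ℂ` of `θ_ι ⊗ 1` is `A^* H`
  have hHc : A.pullback 2 H = e.complexify A.carrier 2 (complexDeRhamCohomology.ofReal A.model A.carrier 2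
      (deRhamCohomology.mk ⟨fubiniStudyPullbackForm A.model ι A.toComplexPoints, hθ⟩)) := by
    rw [hH]
    exact (complexifyFun_ofReal e 2 _).symm
  -- hence `A^* H = r • A^* H₁`, `H = r • H₁`
  have hHH₁ : H = r • H₁ := by
    apply A.pullback_injective 2
    rw [map_smul, key, hmap, hHc, hr']
  have hιcP : complexBetti.map ι 2 cP ≠ 0 := by
    intro h0
    apply hH0
    rw [hHH₁]
    change r • complexBetti.map ι 2 cP = 0
    rw [h0, smul_zero]
  -- `H²(ℙᴺ(ℂ); ℂ) = ℂ · r₀`: `c_P = z₁ • r₀`, `c = z • r₀` with `z ≠ 0`, hence `ι^* c = (z z₁⁻¹) • ι^* c_P ≠ 0`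
  obtain ⟨r₀, -, hgen⟩ := exists_isRationalClass_forall_eq_smul_projectiveSpace N
  obtain ⟨z₁, hz₁⟩ := hgen cP
  obtain ⟨z, hz⟩ := hgen c
  have hιr₀ : complexBetti.map ι 2 r₀ ≠ 0 := by
    intro h0
    exact hιcP (by rw [hz₁, map_smul, h0, smul_zero])
  have hz0 : z ≠ 0 := by
    rintro rfl
    exact hc (by rw [hz, zero_smul])
  rw [hz, map_smul]
  exact smul_ne_zero hz0 hιr₀

end HodgeTheory

end Literature.AlgebraicGeometry.HodgeTheory

end
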